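import Mathlib.Topology.Algebra.OpenSubgroup

/-!
# Intersections along directed systems in compact groups (toolkit for [SemiAnbd] §2–§3)

Mochizuki, *Semi-graphs of Anabelioids*, Publ. RIMS **42** (2006) 221–322, Remark 2.2.1 (p. 23)
and the proof of Theorem 3.7 (iii) (p. 41) [cite: MochizukiSemiAnbd2006, Rem. 2.2.1 p.23]: passing
from the finite levels `𝒢_i` of a Galois pro-system to the (tempered or profinite) fundamental group
repeatedly uses the elementary compactness facts collected here (generic, Mathlib-only; requested
by abc-iut-L3-lead ruling ν2 for abc-iut-L3-t11's branch-pair reduction):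

* `nonempty_iInter_of_directed_nonempty_isClosed` — Cantor's intersection theorem in a compact
  space: a directed (under `⊇`) family of nonempty closed sets has nonempty intersection; with the
  variants `exists_mem_forall_of_antitone` (antitone family over a directed preorder, producing a
  point lying in every member — the "uniformisation" of level-wise choices, e.g. compatible
  conjugators `γ ∈ ⋂ γ_i N_i`) and `exists_mem_forall_of_antitone_isClopen`;
* `exists_mem_forall_of_directed` / `_isClopen` — the same, for `Directed (⊇)`-indexed families;
* `exists_mem_forall_of_antitone_of_isCompact` — the same inside a compact SUBSET of an arbitrary
  space (a compact subgroup of a tempered group), via `IsCompact.elim_directed_family_closed`.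

The companion fact "`⋂_i K·N_i = K`" for a separating system of open subgroups is
abc-iut-L3-t11's `iInter_mul_coe_eq_of_isCompact` (`TemperedBranchPairProfinite.lean`) and is not
repeated here.
-/

namespace Literature.GroupTheory.CompactGroupIntersections

open Topology

universe u v

/-! ### Cantor's intersection theorem, in the forms used -/

/-- Cantor's intersection theorem in a compact space: a family of nonempty closed sets, directed
under `⊇`, has nonempty intersection. [cite: MochizukiSemiAnbd2006, Rem. 2.2.1 p.23] -/
theorem nonempty_iInter_of_directed_nonempty_isClosed {Q : Type u} [TopologicalSpace Q]
    [CompactSpace Q] {ι : Type v} [Nonempty ι] (C : ι → Set Q) (hd : Directed (· ⊇ ·) C)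
    (hn : ∀ i, (C i).Nonempty) (hc : ∀ i, IsClosed (C i)) : (⋂ i, C i).Nonempty :=
  IsCompact.nonempty_iInter_of_directed_nonempty_isCompact_isClosed C hd hn
    (fun i => (hc i).isCompact) hc

/-- **Uniformisation of level-wise choices**: over a directed preorder of levels, an antitone
family of nonempty closed subsets of a compact space has a common point (one choice that works at
every level). [cite: MochizukiSemiAnbd2006, Rem. 2.2.1 p.23] -/
theorem exists_mem_forall_of_antitone {Q : Type u} [TopologicalSpace Q] [CompactSpace Q]
    {J : Type v} [Preorder J] [IsDirectedOrder J] [Nonempty J] (C : J → Set Q)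
    (hanti : ∀ ⦃i j : J⦄, i ≤ j → C j ⊆ C i) (hn : ∀ j, (C j).Nonempty)
    (hc : ∀ j, IsClosed (C j)) : ∃ q : Q, ∀ j, q ∈ C j := by
  have hd : Directed (· ⊇ ·) C := directed_of_isDirected_le fun i j h => hanti h
  obtain ⟨q, hq⟩ := nonempty_iInter_of_directed_nonempty_isClosed C hd hn hc
  exact ⟨q, fun j => Set.mem_iInter.mp hq j⟩

/-- The clopen form of the uniformisation step ("`C_i` nonempty clopen decreasing in the compact
`Q` ⇒ `⋂ C_i ≠ ∅`"). [cite: MochizukiSemiAnbd2006, Rem. 2.2.1 p.23] -/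
theorem exists_mem_forall_of_antitone_isClopen {Q : Type u} [TopologicalSpace Q] [CompactSpace Q]
    {J : Type v} [Preorder J] [IsDirectedOrder J] [Nonempty J] (C : J → Set Q)
    (hanti : ∀ ⦃i j : J⦄, i ≤ j → C j ⊆ C i) (hn : ∀ j, (C j).Nonempty)
    (hc : ∀ j, IsClopen (C j)) : ∃ q : Q, ∀ j, q ∈ C j :=
  exists_mem_forall_of_antitone C hanti hn fun j => (hc j).1

/-! ### Set-indexed (`Directed`) forms of the uniformisation step -/

/-- Uniformisation, `Directed`-indexed form: a family of nonempty closed subsets of a compact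
space, directed under `⊇`, has a common point. [cite: MochizukiSemiAnbd2006, Rem. 2.2.1 p.23] -/
theorem exists_mem_forall_of_directed {Q : Type u} [TopologicalSpace Q] [CompactSpace Q]
    {ι : Type v} [Nonempty ι] (C : ι → Set Q) (hd : Directed (· ⊇ ·) C)
    (hn : ∀ i, (C i).Nonempty) (hc : ∀ i, IsClosed (C i)) : ∃ q : Q, ∀ i, q ∈ C i := by
  obtain ⟨q, hq⟩ := nonempty_iInter_of_directed_nonempty_isClosed C hd hn hc
  exact ⟨q, fun i => Set.mem_iInter.mp hq i⟩

/-- Uniformisation, `Directed`-indexed clopen form. [cite: MochizukiSemiAnbd2006, Rem. 2.2.1 p.23] -/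
theorem exists_mem_forall_of_directed_isClopen {Q : Type u} [TopologicalSpace Q] [CompactSpace Q]
    {ι : Type v} [Nonempty ι] (C : ι → Set Q) (hd : Directed (· ⊇ ·) C)
    (hn : ∀ i, (C i).Nonempty) (hc : ∀ i, IsClopen (C i)) : ∃ q : Q, ∀ i, q ∈ C i :=
  exists_mem_forall_of_directed C hd hn fun i => (hc i).1

/-- Uniformisation inside a compact SUBSET `K` of an arbitrary space (e.g. a compact subgroup of a
tempered group): closed sets `C_j`, antitone over a directed preorder, each meeting `K`, have a
common point in `K`. [cite: MochizukiSemiAnbd2006, Rem. 2.2.1 p.23] -/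
theorem exists_mem_forall_of_antitone_of_isCompact {X : Type u} [TopologicalSpace X]
    {J : Type v} [Preorder J] [IsDirectedOrder J] [Nonempty J] {K : Set X} (hK : IsCompact K)
    (C : J → Set X) (hanti : ∀ ⦃i j : J⦄, i ≤ j → C j ⊆ C i) (hn : ∀ j, (K ∩ C j).Nonempty)
    (hc : ∀ j, IsClosed (C j)) : ∃ q ∈ K, ∀ j, q ∈ C j := by
  have hd : Directed (· ⊇ ·) C := directed_of_isDirected_le fun i j h => hanti h
  have hne : (K ∩ ⋂ j, C j).Nonempty := by
    by_contra h
    rw [Set.not_nonempty_iff_eq_empty] at h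
    obtain ⟨j, hj⟩ := hK.elim_directed_family_closed C hc h hd
    exact (hn j).ne_empty hj
  obtain ⟨q, hqK, hq⟩ := hne
  exact ⟨q, hqK, fun j => Set.mem_iInter.mp hq j⟩

end Literature.GroupTheory.CompactGroupIntersections
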